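import Literature.MathematicalPhysics.KineticTheory.DiPernaLionsCollisionTerms
import Literature.MathematicalPhysics.KineticTheory.DiPernaLionsMildLimitProofs
import HarnessLib

/-!
# The uniform time equicontinuity of the DiPerna–Lions approximate solutions (CIP Step 10)

Topic: MathematicalPhysics / KineticTheory. Proofs-only file: the named fact (EQ)
`Kinetic.diPernaLions_approx_equicontinuous` of
`Literature.MathematicalPhysics.KineticTheory.DiPernaLionsExtraction` (Cercignani–Illner–Pulvirenti
1994 §5.3 Step 10, pp. 151–152: `sup_{t ∈ [0,T]} sup_n ‖f^{n♯}(t + h) - f^{n♯}(t)‖_{L¹} → 0` as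
`h → 0`) is **derived** from the weak-compactness fact (D3)
`Kinetic.diPernaLions_approx_collisionTerms_weaklyCompact` (CIP Lemma 5.3.7) of
`Literature.MathematicalPhysics.KineticTheory.DiPernaLionsCollisionTerms`:
`Kinetic.diPernaLions_approx_equicontinuous_of`.

The printed argument, made quantitative:
* *along characteristics* (`IsDiPernaLionsApproximateSolution.hasDerivAt_sharp`,
  `.ofReal_abs_logTrunc_sub_le`): the truncated equation gives
  `d/ds β_κ(fⁿ)(s, x + s v, v) = (1 + κ fⁿ)⁻¹ Q̃ⁿ(fⁿ,fⁿ)♯`, and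
  `(1 + κ y)⁻¹ |Q̃| ≤ κ⁻¹ (|G| + |L|)` with `G`, `L` the normalised weighted gain/loss terms
  `a Q±(f,f)/(1 + f)` of (D3) (`Kinetic.renormalised_term_le`), whence by the fundamental theorem
  of calculus and the invariance of Lebesgue measure under the free-streaming shear
  (`Kinetic.lintegral_box_le_of_characteristic_bound`)
  `∫_{E × B_R} |β_κ(f^{n♯})(t₂) - β_κ(f^{n♯})(t)| ≤ κ⁻¹ ∫_{(t,t₂] × E × B_R} (|Gₙ| + |Lₙ|)`
  (`IsDiPernaLionsApproximateSolution.lintegral_inner_logTrunc_increment_le`);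
* *thin slabs are uniformly small* for an equi-integrable, uniformly tight family
  (`Kinetic.exists_slab_lintegral_le`), which is what (D3) provides;
* *truncation errors* `∫∫ (fⁿ - β_κ(fⁿ)) ≤ (κ M + (log M)⁻¹) C` by (3.30)
  (`Kinetic.lintegral_sub_logTrunc_le`) and *velocity tails* `≤ C/(1 + R²)` by the second
  moments (`Kinetic.lintegral_velocityTail_le`), both uniformly in `n` and `t ∈ [0, T + 2]` by
  (3.21)–(3.22);
* the five-term splitting `IsDiPernaLionsApproximateSolution.lintegral_sharp_increment_le` and the
  choice of `R`, `M`, `κ`, `h₀` in terms of `ε` (`Kinetic.diPernaLions_approx_equicontinuous_of`).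

State of the decomposition of `Hilbert6.diperna_lions` after this file: `diperna_lions` ⇐
(A) + (B); (A) ⇐ A1, A2a–c, A3a–b; (B) ⇐ B1, S14, D5, B3; D5 proved; S14 ⇐ E49, L12;
B1 ⇐ EQ (`DiPernaLionsExtractionProofs`); EQ ⇐ D3 (this file). Remaining named facts:
A1, A2a, A2b, A2c, A3a, A3b, D3, B3, E49, L12.

## References
* C. Cercignani, R. Illner, M. Pulvirenti, *The Mathematical Theory of Dilute Gases*, Springer
  1994, §5.3 Step 10. [cite: CIPDiluteGases1994, §5.3 Step 10 (pp. 151–152)]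
* R. J. DiPerna, P.-L. Lions, Ann. of Math. 130 (1989) 321–366. [cite: DiPernaLionsAnnals1989, §IV]
-/

open MeasureTheory Metric Real Set Filter Topology
open scoped InnerProductSpace ENNReal

noncomputable section

namespace Literature.MathematicalPhysics.KineticTheory

/-! ## Collision integrals of the approximate solutions -/

section Approx

variable {E : Type*} [NormedAddCommGroup E] [InnerProductSpace ℝ E] [FiniteDimensional ℝ E]
  [MeasurableSpace E] [BorelSpace E]

/-- For a bounded DiPerna–Lions kernel vanishing for large relative velocities and a continuous,
bounded, integrable velocity density, the gain and loss integrands are absolutely integrable at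
every velocity. [folklore] -/
theorem gain_loss_integrable_of_bounded_kernel {B : E × E → sphere (0 : E) 1 → ℝ}
    (hBk : KineticTheory.IsDiPernaLionsKernel B) {Cb : ℝ} (hCb : ∀ p ω, B p ω ≤ Cb) {Rb : ℝ}
    (hRb : ∀ (z : E) ω, Rb ≤ ‖z‖ → B (z, 0) ω = 0) {g : E → ℝ} (hgc : Continuous g) {K : ℝ}
    (hK : ∀ w, |g w| ≤ K) (hgi : Integrable g) (v : E) :
    Integrable (fun q : E × sphere (0 : E) 1 => B (v, q.1) q.2 *
        (g (KineticTheory.collide q.2 (v, q.1)).1 * g (KineticTheory.collide q.2 (v, q.1)).2))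
      (volume.prod KineticTheory.sphereMeasure) ∧
    Integrable (fun q : E × sphere (0 : E) 1 => B (v, q.1) q.2 * (g v * g q.1))
      (volume.prod KineticTheory.sphereMeasure) := by
  haveI := Literature.Analysis.FluidPDE.isFiniteMeasure_sphereMeasure (E := E)
  have hK0 : 0 ≤ K := (abs_nonneg _).trans (hK v)
  have hBm : Measurable fun q : E × sphere (0 : E) 1 => B (v, q.1) q.2 :=
    hBk.measurable.comp ((measurable_const.prodMk measurable_fst).prodMk measurable_snd)
  have hcol : Continuous fun q : E × sphere (0 : E) 1 => KineticTheory.collide q.2 (v, q.1) :=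
    Literature.Analysis.FluidPDE.continuous_collide_uncurry.comp ((continuous_const.prodMk continuous_fst).prodMk continuous_snd)
  constructor
  · -- gain: bounded by `Cb K² 1_{B̄(v, Rb)}(w)`
    have hmeas : AEStronglyMeasurable (fun q : E × sphere (0 : E) 1 => B (v, q.1) q.2 *
        (g (KineticTheory.collide q.2 (v, q.1)).1 * g (KineticTheory.collide q.2 (v, q.1)).2))
        (volume.prod KineticTheory.sphereMeasure) :=
      (hBm.mul (((hgc.comp (continuous_fst.comp hcol)).mul
        (hgc.comp (continuous_snd.comp hcol))).measurable)).aestronglyMeasurable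
    have hdom : Integrable (fun q : E × sphere (0 : E) 1 =>
        (closedBall v Rb).indicator (fun _ => Cb * K * K) q.1 * (1 : ℝ))
        (volume.prod KineticTheory.sphereMeasure) := by
      refine Integrable.mul_prod ?_ (integrable_const (μ := KineticTheory.sphereMeasure) (1 : ℝ))
      exact (integrableOn_const (measure_closedBall_lt_top (x := v) (r := Rb)).ne).integrable_indicator
        measurableSet_closedBall
    refine hdom.mono' hmeas (ae_of_all _ fun q => ?_)
    rw [Real.norm_eq_abs, mul_one]
    by_cases hq : q.1 ∈ closedBall v Rb
    · rw [indicator_of_mem hq, abs_mul, abs_mul, abs_of_nonneg (hBk.nonneg _ _)]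
      have h1 : B (v, q.1) q.2 ≤ Cb := hCb _ _
      have h2 := hK (KineticTheory.collide q.2 (v, q.1)).1
      have h3 := hK (KineticTheory.collide q.2 (v, q.1)).2
      have := mul_le_mul h1 (mul_le_mul h2 h3 (abs_nonneg _) hK0) (by positivity) ((hBk.nonneg _ _).trans h1)
      linarith [this]
    · rw [indicator_of_notMem hq]
      have hfar : Rb ≤ ‖v - q.1‖ := by
        rw [mem_closedBall, dist_eq_norm, not_le] at hq
        rw [← norm_neg, neg_sub] at hq  -- ‖q.1 - v‖ → ‖v - q.1‖
        exact hq.le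
      have h0 : B (v, q.1) q.2 = 0 := by
        have := hBk.sub_right (v - q.1) 0 q.1 q.2
        rw [sub_add_cancel, zero_add] at this
        rw [this]
        exact hRb _ _ hfar
      rw [h0, zero_mul, abs_zero]
  · -- loss: bounded by `Cb |g v| |g w|`
    have hmeas : AEStronglyMeasurable (fun q : E × sphere (0 : E) 1 => B (v, q.1) q.2 * (g v * g q.1))
        (volume.prod KineticTheory.sphereMeasure) :=
      (hBm.mul (measurable_const.mul (hgc.measurable.comp measurable_fst))).aestronglyMeasurable
    have hdom : Integrable (fun q : E × sphere (0 : E) 1 => Cb * |g v| * |g q.1| * (1 : ℝ))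
        (volume.prod KineticTheory.sphereMeasure) :=
      (hgi.abs.const_mul (Cb * |g v|)).mul_prod (integrable_const (μ := KineticTheory.sphereMeasure) (1 : ℝ))
    refine hdom.mono' hmeas (ae_of_all _ fun q => ?_)
    rw [Real.norm_eq_abs, mul_one, abs_mul, abs_mul, abs_of_nonneg (hBk.nonneg _ _)]
    have h1 : B (v, q.1) q.2 ≤ Cb := hCb _ _
    calc B (v, q.1) q.2 * (|g v| * |g q.1|) ≤ Cb * (|g v| * |g q.1|) :=
          mul_le_mul_of_nonneg_right h1 (by positivity)
      _ = Cb * |g v| * |g q.1| := by ring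

/-- `|Q(g,g)| ≤ Q⁺(g,g) + Q⁻(g,g)` at points where both collision integrals converge absolutely,
for a nonnegative kernel and density. [folklore] -/
theorem abs_collisionOpWith_le {B : E × E → sphere (0 : E) 1 → ℝ} (hB0 : ∀ p ω, 0 ≤ B p ω)
    {g : E → ℝ} (hg : ∀ w, 0 ≤ g w) (v : E)
    (hgain : Integrable (fun q : E × sphere (0 : E) 1 => B (v, q.1) q.2 *
        (g (KineticTheory.collide q.2 (v, q.1)).1 * g (KineticTheory.collide q.2 (v, q.1)).2))
      (volume.prod KineticTheory.sphereMeasure))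
    (hloss : Integrable (fun q : E × sphere (0 : E) 1 => B (v, q.1) q.2 * (g v * g q.1))
      (volume.prod KineticTheory.sphereMeasure)) :
    |Literature.Analysis.FluidPDE.collisionOpWith B g g v| ≤ Literature.Analysis.FluidPDE.gainWith B g g v + Literature.Analysis.FluidPDE.lossWith B g g v := by
  rw [collisionOpWith_eq_gainWith_sub_lossWith_holds B g g v hgain hloss]
  have h1 := gainWith_nonneg hB0 hg v
  have h2 : 0 ≤ Literature.Analysis.FluidPDE.lossWith B g g v :=
    integral_nonneg fun _ => integral_nonneg fun _ => mul_nonneg (hB0 _ _) (mul_nonneg (hg _) (hg _))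
  rw [abs_le]; constructor <;> linarith

/-- The slices of an approximate solution are continuous, bounded and integrable. [folklore] -/
theorem IsDiPernaLionsApproximateSolution.slice_velocity {δ : ℝ} {B : E × E → sphere (0 : E) 1 → ℝ}
    {f : ℝ → E → E → ℝ} (hf : IsDiPernaLionsApproximateSolution δ B f) {t : ℝ} (ht : 0 ≤ t)
    (x : E) :
    Continuous (f t x) ∧ (∃ K, ∀ w, |f t x w| ≤ K) ∧ Integrable (f t x) := by
  have hS := hf.sliceSchwartz t ht
  have hc : Continuous fun z : E × E => f t z.1 z.2 := (hf.contDiff_slice t ht).continuous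
  refine ⟨hc.comp (continuous_const.prodMk continuous_id), ?_, ?_⟩
  · obtain ⟨C, hC⟩ := hf.decay_slice t ht 0 0
    refine ⟨C, fun w => ?_⟩
    have := hC t ⟨ht, le_rfl⟩ (x, w)
    simpa [norm_iteratedFDeriv_zero] using this
  · -- integrability of the section `w ↦ f t x w` of the Schwartz function
    set k : ℕ := (volume : Measure E).integrablePower with hk
    obtain ⟨C, hC⟩ := hf.decay_slice t ht k 0
    have hb : ∀ w, ‖w‖ ^ (0 + k) * ‖f t x w‖ ≤ C := fun w => by
      have h1 := hC t ⟨ht, le_rfl⟩ (x, w)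
      simp only [norm_iteratedFDeriv_zero] at h1
      rw [zero_add]
      refine le_trans (mul_le_mul_of_nonneg_right (pow_le_pow_left₀ (norm_nonneg _)
        (norm_snd_le (x, w)) k) (norm_nonneg _)) h1
    obtain ⟨K, hK⟩ : ∃ K, ∀ w, ‖f t x w‖ ≤ K := by
      obtain ⟨C0, hC0⟩ := hf.decay_slice t ht 0 0
      exact ⟨C0, fun w => by simpa [norm_iteratedFDeriv_zero] using hC0 t ⟨ht, le_rfl⟩ (x, w)⟩
    have hm : AEStronglyMeasurable (f t x) (volume : Measure E) :=
      (hc.comp (continuous_const.prodMk continuous_id)).aestronglyMeasurable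
    have := integrable_of_le_of_pow_mul_le (μ := (volume : Measure E)) hK hb hm
    simp only [pow_zero, one_mul] at this
    exact (integrable_norm_iff hm).1 this

end Approx


/-! ## Calculus along characteristics for the approximate solutions -/

section Characteristics

variable {E : Type*} [NormedAddCommGroup E] [InnerProductSpace ℝ E] [FiniteDimensional ℝ E]
  [MeasurableSpace E] [BorelSpace E]

omit [FiniteDimensional ℝ E] [MeasurableSpace E] [BorelSpace E] in
/-- Local form of `deriv_add_fderiv_eq_fderiv`: for `Φ` differentiable at `(t, x, v)`,
`∂ₜφ + v·∇ₓφ = DΦ(t,x,v)(1, v, 0)`. [folklore] -/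
theorem deriv_add_fderiv_eq_fderiv_of_differentiableAt {φ : ℝ → E → E → ℝ} {t : ℝ} {x v : E}
    (hφ : DifferentiableAt ℝ (fun z : ℝ × E × E => φ z.1 z.2.1 z.2.2) (t, x, v)) :
    deriv (fun s => φ s x v) t + fderiv ℝ (fun y => φ t y v) x v =
      fderiv ℝ (fun z : ℝ × E × E => φ z.1 z.2.1 z.2.2) (t, x, v) ((1 : ℝ), v, (0 : E)) := by
  set Φ : ℝ × E × E → ℝ := fun z => φ z.1 z.2.1 z.2.2 with hΦ
  have hΦ' : HasFDerivAt Φ (fderiv ℝ Φ (t, x, v)) (t, x, v) := hφ.hasFDerivAt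
  have hγ : HasDerivAt (fun s : ℝ => ((s, x, v) : ℝ × E × E)) ((1 : ℝ), (0 : E), (0 : E)) t :=
    (hasDerivAt_id t).prodMk ((hasDerivAt_const t x).prodMk (hasDerivAt_const t v))
  have h1 : deriv (fun s => φ s x v) t = fderiv ℝ Φ (t, x, v) ((1 : ℝ), (0 : E), (0 : E)) := by
    have := hΦ'.comp_hasDerivAt t hγ
    exact this.deriv
  set L : E →L[ℝ] ℝ × E × E := (0 : E →L[ℝ] ℝ).prod ((ContinuousLinearMap.id ℝ E).prod 0)
    with hL
  have hι : HasFDerivAt (fun y : E => ((t, y, v) : ℝ × E × E)) L x :=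
    (hasFDerivAt_const t x).prodMk ((hasFDerivAt_id x).prodMk (hasFDerivAt_const v x))
  have h2 : fderiv ℝ (fun y => φ t y v) x v = fderiv ℝ Φ (t, x, v) ((0 : ℝ), v, (0 : E)) := by
    have := (hΦ'.comp x hι).fderiv
    rw [show (fun y => φ t y v) = Φ ∘ fun y : E => ((t, y, v) : ℝ × E × E) from rfl, this]
    simp [hL]
  rw [h1, h2, ← map_add]
  simp

/-- **The truncated equation along characteristics**: for an approximate solution and `s > 0`,
`d/ds f(s, x + s v, v) = Q̃_δ(f, f)(s, x + s v, v)`, and this derivative is the Fréchet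
derivative of `f` in the direction `(1, v, 0)`. [folklore] -/
theorem IsDiPernaLionsApproximateSolution.hasDerivAt_sharp {δ : ℝ}
    {B : E × E → sphere (0 : E) 1 → ℝ} {f : ℝ → E → E → ℝ}
    (hf : IsDiPernaLionsApproximateSolution δ B f) {s : ℝ} (hs : 0 < s) (x v : E) :
    HasDerivAt (fun σ => f σ (x + σ • v) v)
      (fderiv ℝ (fun z : ℝ × E × E => f z.1 z.2.1 z.2.2) (s, x + s • v, v) ((1 : ℝ), v, (0 : E))) s ∧
    fderiv ℝ (fun z : ℝ × E × E => f z.1 z.2.1 z.2.2) (s, x + s • v, v) ((1 : ℝ), v, (0 : E)) =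
      truncatedCollisionOp δ B (f s (x + s • v)) v := by
  set F : ℝ × E × E → ℝ := fun z => f z.1 z.2.1 z.2.2 with hF
  have hmem : (s, x + s • v, v) ∈ Ioi (0 : ℝ) ×ˢ (univ : Set (E × E)) := ⟨hs, mem_univ _⟩
  have hopen : IsOpen (Ioi (0 : ℝ) ×ˢ (univ : Set (E × E))) := isOpen_Ioi.prod isOpen_univ
  have hnhds : Ici (0 : ℝ) ×ˢ (univ : Set (E × E)) ∈ 𝓝 (s, x + s • v, v) :=
    Filter.mem_of_superset (hopen.mem_nhds hmem) (prod_mono Ioi_subset_Ici_self subset_rfl)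
  have hFd : DifferentiableAt ℝ F (s, x + s • v, v) :=
    ((hf.contDiffOn.differentiableOn one_ne_zero) _
      (⟨(hs.le : (0 : ℝ) ≤ s), mem_univ _⟩ : (s, x + s • v, v) ∈ Ici (0 : ℝ) ×ˢ (univ : Set (E × E)))).differentiableAt hnhds
  have hγ : HasDerivAt (fun σ : ℝ => ((σ, x + σ • v, v) : ℝ × E × E)) ((1 : ℝ), v, (0 : E)) s := by
    have h2 : HasDerivAt (fun σ : ℝ => x + σ • v) v s := by
      simpa using ((hasDerivAt_id s).smul_const v).const_add x
    exact (hasDerivAt_id s).prodMk (h2.prodMk (hasDerivAt_const s v))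
  refine ⟨?_, ?_⟩
  · have := hFd.hasFDerivAt.comp_hasDerivAt s hγ
    exact this
  · rw [← deriv_add_fderiv_eq_fderiv_of_differentiableAt hFd, ← hf.eqn s hs.le (x + s • v) v,
      derivWithin_of_mem_nhds (Ici_mem_nhds hs)]

/-- The derivative along a characteristic is continuous in `s > 0`. [folklore] -/
theorem IsDiPernaLionsApproximateSolution.continuousOn_fderiv_sharp {δ : ℝ}
    {B : E × E → sphere (0 : E) 1 → ℝ} {f : ℝ → E → E → ℝ}
    (hf : IsDiPernaLionsApproximateSolution δ B f) (x v : E) :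
    ContinuousOn (fun σ : ℝ => fderiv ℝ (fun z : ℝ × E × E => f z.1 z.2.1 z.2.2)
      (σ, x + σ • v, v) ((1 : ℝ), v, (0 : E))) (Ioi 0) := by
  set F : ℝ × E × E → ℝ := fun z => f z.1 z.2.1 z.2.2 with hF
  have hopen : IsOpen (Ioi (0 : ℝ) ×ˢ (univ : Set (E × E))) := isOpen_Ioi.prod isOpen_univ
  have hF' : ContDiffOn ℝ 1 F (Ioi (0 : ℝ) ×ˢ (univ : Set (E × E))) :=
    hf.contDiffOn.mono (prod_mono Ioi_subset_Ici_self subset_rfl)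
  have hc : ContinuousOn (fderiv ℝ F) (Ioi (0 : ℝ) ×ˢ (univ : Set (E × E))) :=
    hF'.continuousOn_fderiv_of_isOpen hopen le_rfl
  have hγc : Continuous fun σ : ℝ => ((σ, x + σ • v, v) : ℝ × E × E) := by fun_prop
  have hmaps : MapsTo (fun σ : ℝ => ((σ, x + σ • v, v) : ℝ × E × E)) (Ioi 0)
      (Ioi (0 : ℝ) ×ˢ (univ : Set (E × E))) := fun σ hσ => ⟨hσ, mem_univ _⟩
  have h1 : ContinuousOn (fun σ : ℝ => fderiv ℝ F (σ, x + σ • v, v)) (Ioi 0) :=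
    hc.comp hγc.continuousOn hmaps
  exact (ContinuousLinearMap.apply ℝ ℝ (((1 : ℝ), v, (0 : E)) : ℝ × E × E)).continuous.comp_continuousOn h1

/-- The values of an approximate solution along a characteristic are continuous on `[0, ∞)`.
[folklore] -/
theorem IsDiPernaLionsApproximateSolution.continuousOn_sharp {δ : ℝ}
    {B : E × E → sphere (0 : E) 1 → ℝ} {f : ℝ → E → E → ℝ}
    (hf : IsDiPernaLionsApproximateSolution δ B f) (x v : E) :
    ContinuousOn (fun σ : ℝ => f σ (x + σ • v) v) (Ici 0) := by
  have hγc : Continuous fun σ : ℝ => ((σ, x + σ • v, v) : ℝ × E × E) := by fun_prop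
  exact hf.continuousOn_uncurry.comp hγc.continuousOn fun σ hσ => ⟨hσ, mem_univ _⟩

/-- **FTC inequality for `β_κ(f♯)`**, interior version: for `0 < t ≤ t₂`,
`|β_κ(f♯(t₂)) - β_κ(f♯(t))| ≤ ∫_t^{t₂} (1 + κ f♯)⁻¹ |Q̃_δ(f,f)♯| ds` (as an inequality in
`[0, ∞]`). [folklore] -/
theorem IsDiPernaLionsApproximateSolution.ofReal_abs_logTrunc_sub_le_of_pos {δ : ℝ}
    {B : E × E → sphere (0 : E) 1 → ℝ} {f : ℝ → E → E → ℝ}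
    (hf : IsDiPernaLionsApproximateSolution δ B f) {κ : ℝ} (hκ : 0 < κ) {t t₂ : ℝ} (ht : 0 < t)
    (htt : t ≤ t₂) (x v : E) :
    ENNReal.ofReal |logTrunc κ (f t₂ (x + t₂ • v) v) - logTrunc κ (f t (x + t • v) v)| ≤
      ∫⁻ s in Ioc t t₂, ENNReal.ofReal ((1 + κ * f s (x + s • v) v)⁻¹ *
        |truncatedCollisionOp δ B (f s (x + s • v)) v|) := by
  set D : ℝ → ℝ := fun σ => fderiv ℝ (fun z : ℝ × E × E => f z.1 z.2.1 z.2.2)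
    (σ, x + σ • v, v) ((1 : ℝ), v, (0 : E)) with hD
  set u : ℝ → ℝ := fun σ => f σ (x + σ • v) v with hu
  set G : ℝ → ℝ := fun σ => logTrunc κ (u σ) with hG
  set G' : ℝ → ℝ := fun σ => (1 + κ * u σ)⁻¹ * D σ with hG'
  have hu0 : ∀ σ, 0 ≤ σ → 0 ≤ u σ := fun σ hσ => hf.nonneg σ hσ _ _
  have huc : ContinuousOn u (Icc t t₂) :=
    (hf.continuousOn_sharp x v).mono fun σ hσ => (ht.le.trans hσ.1 : 0 ≤ σ)
  have hDc : ContinuousOn D (Icc t t₂) :=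
    (hf.continuousOn_fderiv_sharp x v).mono fun σ hσ => (ht.trans_le hσ.1 : 0 < σ)
  -- derivative of `G`
  have hGd : ∀ σ ∈ Ioo t t₂, HasDerivAt G (G' σ) σ := by
    intro σ hσ
    have hσ0 : 0 < σ := ht.trans hσ.1
    have h1 : HasDerivAt u (D σ) σ := (hf.hasDerivAt_sharp hσ0 x v).1
    have hpos : 0 < 1 + κ * u σ := by nlinarith [hu0 σ hσ0.le]
    have h2 : HasDerivAt (fun σ => 1 + κ * u σ) (κ * D σ) σ := by
      simpa using (h1.const_mul κ).const_add 1
    have h3 := (h2.log hpos.ne').const_mul κ⁻¹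
    refine h3.congr_deriv ?_
    simp only [hG']
    field_simp
  have hG'c : ContinuousOn G' (Icc t t₂) := by
    refine ContinuousOn.mul ?_ hDc
    refine ContinuousOn.inv₀ (continuousOn_const.add (continuousOn_const.mul huc)) fun σ hσ => ?_
    nlinarith [hu0 σ (ht.le.trans hσ.1)]
  have hGc : ContinuousOn G (Icc t t₂) := by
    simp only [hG, logTrunc]
    refine continuousOn_const.mul (ContinuousOn.log (continuousOn_const.add
      (continuousOn_const.mul huc)) fun σ hσ => ?_)
    nlinarith [hu0 σ (ht.le.trans hσ.1)]
  have hint : IntervalIntegrable G' volume t t₂ := hG'c.intervalIntegrable_of_Icc htt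
  have hFTC : ∫ σ in t..t₂, G' σ = G t₂ - G t :=
    intervalIntegral.integral_eq_sub_of_hasDerivAt_of_le htt hGc hGd hint
  -- absolute values
  have habs : |G t₂ - G t| ≤ ∫ σ in Ioc t t₂, |G' σ| := by
    rw [← hFTC, ← intervalIntegral.integral_of_le htt]
    exact intervalIntegral.abs_integral_le_integral_abs htt
  have hI : IntegrableOn (fun σ => |G' σ|) (Ioc t t₂) :=
    ((hG'c.abs).integrableOn_compact isCompact_Icc).mono_set Ioc_subset_Icc_self
  calc ENNReal.ofReal |G t₂ - G t| ≤ ENNReal.ofReal (∫ σ in Ioc t t₂, |G' σ|) :=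
        ENNReal.ofReal_le_ofReal habs
    _ = ∫⁻ σ in Ioc t t₂, ENNReal.ofReal |G' σ| :=
        ofReal_integral_eq_lintegral_ofReal hI (ae_of_all _ fun σ => abs_nonneg _)
    _ = ∫⁻ s in Ioc t t₂, ENNReal.ofReal ((1 + κ * f s (x + s • v) v)⁻¹ *
          |truncatedCollisionOp δ B (f s (x + s • v)) v|) := by
        refine setLIntegral_congr_fun measurableSet_Ioc fun σ hσ => ?_
        have hσ0' : 0 < σ := lt_of_lt_of_le ht hσ.1.le
        have hDσ : D σ = truncatedCollisionOp δ B (f σ (x + σ • v)) v := (hf.hasDerivAt_sharp hσ0' x v).2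
        simp only [hG', hu]
        rw [abs_mul, abs_of_pos (inv_pos.2 (by nlinarith [hu0 σ hσ0'.le])), hDσ]

end Characteristics


/-! ## From the FTC inequality to slab integrals -/

section Slab

variable {E : Type*} [NormedAddCommGroup E] [InnerProductSpace ℝ E] [FiniteDimensional ℝ E]
  [MeasurableSpace E] [BorelSpace E]

/-- Pointwise bound of the renormalised collision term by the normalised, weighted gain and loss
terms: `(1 + κ y)⁻¹ |Q̃_δ(g,g)(v)| ≤ κ⁻¹ [a Q⁺/(1+y) + a Q⁻/(1+y)]`, `a = (1 + δ ∫|g|)⁻¹`,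
`y = g(v) ≥ 0`, `0 < κ ≤ 1`, `δ ≥ 0`, when `|Q| ≤ Q⁺ + Q⁻`. [folklore] -/
theorem renormalised_term_le {B : E × E → sphere (0 : E) 1 → ℝ} {g : E → ℝ} {v : E}
    (hQ : |Literature.Analysis.FluidPDE.collisionOpWith B g g v| ≤ Literature.Analysis.FluidPDE.gainWith B g g v + Literature.Analysis.FluidPDE.lossWith B g g v) (hgv : 0 ≤ g v)
    {δ κ : ℝ} (hδ : 0 ≤ δ) (hκ : 0 < κ) (hκ1 : κ ≤ 1) :
    (1 + κ * g v)⁻¹ * |truncatedCollisionOp δ B g v| ≤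
      κ⁻¹ * ((1 + δ * ∫ w, |g w|)⁻¹ * Literature.Analysis.FluidPDE.gainWith B g g v / (1 + g v) +
        (1 + δ * ∫ w, |g w|)⁻¹ * Literature.Analysis.FluidPDE.lossWith B g g v / (1 + g v)) := by
  set a : ℝ := (1 + δ * ∫ w, |g w|)⁻¹ with ha
  have ha0 : 0 ≤ a := inv_nonneg.2 (by positivity)
  have h1 : |truncatedCollisionOp δ B g v| = a * |Literature.Analysis.FluidPDE.collisionOpWith B g g v| := by
    rw [truncatedCollisionOp, abs_mul, abs_of_nonneg ha0]
  have h2 := inv_one_add_mul_le hκ hκ1 hgv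
  have hGL : 0 ≤ Literature.Analysis.FluidPDE.gainWith B g g v + Literature.Analysis.FluidPDE.lossWith B g g v := (abs_nonneg _).trans hQ
  rw [h1]
  calc (1 + κ * g v)⁻¹ * (a * |Literature.Analysis.FluidPDE.collisionOpWith B g g v|)
      ≤ (κ⁻¹ * (1 + g v)⁻¹) * (a * (Literature.Analysis.FluidPDE.gainWith B g g v + Literature.Analysis.FluidPDE.lossWith B g g v)) :=
        mul_le_mul h2 (mul_le_mul_of_nonneg_left hQ ha0) (by positivity) (by positivity)
    _ = κ⁻¹ * ((1 + δ * ∫ w, |g w|)⁻¹ * Literature.Analysis.FluidPDE.gainWith B g g v / (1 + g v) +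
        (1 + δ * ∫ w, |g w|)⁻¹ * Literature.Analysis.FluidPDE.lossWith B g g v / (1 + g v)) := by
        simp only [ha]; ring

/-- **FTC inequality for `β_κ(f♯)` on `[t, t₂]`, `t ≥ 0`**, with a majorant `Ψ` of the
renormalised collision term along characteristics (interior version plus right-continuity at
`t`). [folklore] -/
theorem IsDiPernaLionsApproximateSolution.ofReal_abs_logTrunc_sub_le {δ : ℝ}
    {B : E × E → sphere (0 : E) 1 → ℝ} {f : ℝ → E → E → ℝ}
    (hf : IsDiPernaLionsApproximateSolution δ B f) {κ : ℝ} (hκ : 0 < κ)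
    {Ψ : ℝ × E × E → ℝ≥0∞}
    (hΨ : ∀ s > (0 : ℝ), ∀ y v : E, ENNReal.ofReal ((1 + κ * f s y v)⁻¹ *
      |truncatedCollisionOp δ B (f s y) v|) ≤ Ψ (s, y, v))
    {t t₂ : ℝ} (ht : 0 ≤ t) (htt : t ≤ t₂) (x v : E) :
    ENNReal.ofReal |logTrunc κ (f t₂ (x + t₂ • v) v) - logTrunc κ (f t (x + t • v) v)| ≤
      ∫⁻ s in Ioc t t₂, Ψ (s, x + s • v, v) := by
  rcases htt.eq_or_lt with rfl | hlt
  · simp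
  set G : ℝ → ℝ := fun τ => logTrunc κ (f τ (x + τ • v) v) with hG
  have hstep : ∀ τ ∈ Ioc t t₂, ENNReal.ofReal |G t₂ - G τ| ≤ ∫⁻ s in Ioc t t₂, Ψ (s, x + s • v, v) := by
    intro τ hτ
    have hτ0 : 0 < τ := ht.trans_lt hτ.1
    calc ENNReal.ofReal |G t₂ - G τ|
        ≤ ∫⁻ s in Ioc τ t₂, ENNReal.ofReal ((1 + κ * f s (x + s • v) v)⁻¹ *
            |truncatedCollisionOp δ B (f s (x + s • v)) v|) :=
          hf.ofReal_abs_logTrunc_sub_le_of_pos hκ hτ0 hτ.2 x v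
      _ ≤ ∫⁻ s in Ioc τ t₂, Ψ (s, x + s • v, v) :=
          setLIntegral_mono' measurableSet_Ioc fun s hs => hΨ s (hτ0.trans hs.1) _ _
      _ ≤ ∫⁻ s in Ioc t t₂, Ψ (s, x + s • v, v) :=
          lintegral_mono_set (Ioc_subset_Ioc_left hτ.1.le)
  -- right-continuity of `G` at `t`
  have h1 : ContinuousWithinAt (fun τ : ℝ => f τ (x + τ • v) v) (Ioi t) t :=
    ((hf.continuousOn_sharp x v) t (mem_Ici.2 ht)).mono fun τ hτ => (ht.trans (le_of_lt hτ) : 0 ≤ τ)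
  have h2 : ContinuousAt (logTrunc κ) (f t (x + t • v) v) :=
    continuousAt_logTrunc hκ (hf.nonneg t ht _ _)
  have hGt : Tendsto G (𝓝[>] t) (𝓝 (G t)) := h2.tendsto.comp h1.tendsto
  have hlim : Tendsto (fun τ => ENNReal.ofReal |G t₂ - G τ|) (𝓝[>] t)
      (𝓝 (ENNReal.ofReal |G t₂ - G t|)) :=
    ENNReal.tendsto_ofReal ((continuous_abs.tendsto _).comp (tendsto_const_nhds.sub hGt))
  exact le_of_tendsto hlim (by
    filter_upwards [Ioc_mem_nhdsGT hlt] with τ hτ using hstep τ hτ)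

omit [FiniteDimensional ℝ E] [MeasurableSpace E] [BorelSpace E] in
/-- The shear flow preserves the slab boxes `(t, t₂] × (E × B̄_R)`. [folklore] -/
theorem shearFlow_preimage_Ioc_box (t t₂ R : ℝ) :
    shearFlow ⁻¹' (Ioc t t₂ ×ˢ ((univ : Set E) ×ˢ closedBall (0 : E) R)) =
      Ioc t t₂ ×ˢ (univ ×ˢ closedBall (0 : E) R) := by
  ext z
  simp

/-- **Space integration of the characteristic bound** (Tonelli in free-flow coordinates and the
invariance of Lebesgue measure under the shear): a pointwise-in-`(x,v)` bound by integrals along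
characteristics integrates to a bound by the slab integral. [folklore] -/
theorem lintegral_box_le_of_characteristic_bound {u : ℝ → E → E → ℝ} {Ψ : ℝ × E × E → ℝ≥0∞}
    (hΨm : Measurable Ψ) {t t₂ : ℝ}
    (hpt : ∀ x v : E, ENNReal.ofReal |u t₂ (x + t₂ • v) v - u t (x + t • v) v| ≤
      ∫⁻ s in Ioc t t₂, Ψ (s, x + s • v, v)) (R : ℝ) :
    ∫⁻ z in (univ : Set E) ×ˢ closedBall (0 : E) R,
        ENNReal.ofReal |u t₂ (z.1 + t₂ • z.2) z.2 - u t (z.1 + t • z.2) z.2| ∂(volume.prod volume) ≤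
      ∫⁻ q in Ioc t t₂ ×ˢ ((univ : Set E) ×ˢ closedBall (0 : E) R), Ψ q := by
  set μs : Measure ℝ := (volume : Measure ℝ).restrict (Ioc t t₂) with hμs
  set μz : Measure (E × E) := ((volume : Measure E).prod volume).restrict
    ((univ : Set E) ×ˢ closedBall (0 : E) R) with hμz
  have hH : Measurable fun p : ℝ × E × E => Ψ (shearFlow p) :=
    hΨm.comp measurableEmbedding_shearFlow.measurable
  calc ∫⁻ z in (univ : Set E) ×ˢ closedBall (0 : E) R,
        ENNReal.ofReal |u t₂ (z.1 + t₂ • z.2) z.2 - u t (z.1 + t • z.2) z.2| ∂(volume.prod volume)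
      ≤ ∫⁻ z, ∫⁻ s, Ψ (shearFlow (s, z)) ∂μs ∂μz := lintegral_mono fun z => by
          simpa [shearFlow_apply] using hpt z.1 z.2
    _ = ∫⁻ p, Ψ (shearFlow p) ∂(μs.prod μz) := (lintegral_prod_symm _ hH.aemeasurable).symm
    _ = ∫⁻ p in Ioc t t₂ ×ˢ ((univ : Set E) ×ˢ closedBall (0 : E) R), Ψ (shearFlow p) := by
          rw [hμs, hμz, Measure.prod_restrict]; rfl
    _ = ∫⁻ q in Ioc t t₂ ×ˢ ((univ : Set E) ×ˢ closedBall (0 : E) R), Ψ q := by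
          have hmp : MeasurePreserving (shearFlow (E := E))
              ((volume : Measure (ℝ × E × E)).restrict (Ioc t t₂ ×ˢ (univ ×ˢ closedBall (0 : E) R)))
              ((volume : Measure (ℝ × E × E)).restrict (Ioc t t₂ ×ˢ (univ ×ˢ closedBall (0 : E) R))) := by
            have h := (measurePreserving_shearFlow (E := E)).restrict_preimage
              (s := Ioc t t₂ ×ˢ ((univ : Set E) ×ˢ closedBall (0 : E) R))
              (measurableSet_Ioc.prod (MeasurableSet.univ.prod measurableSet_closedBall))
            rwa [shearFlow_preimage_Ioc_box] at h
          exact hmp.lintegral_comp hΨm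

/-- **Uniformly small slab integrals from equi-integrability and tightness.** If a family `F n`
is equi-integrable and uniformly tight in `L¹` of Lebesgue measure restricted to
`S₀ ⊆ ℝ × E × B̄_R`, then its integrals over the time slabs `(t, t + h] × E × E` are small,
uniformly in `n` and `t`, for small `h` (the slab meets a large box in a set of measure
`≤ h |B_ρ| |B_R|`, the tight set outside the box has small measure, and the rest is the tail).
[folklore] -/
theorem exists_slab_lintegral_le {S₀ : Set (ℝ × E × E)} {R : ℝ}
    (hS₀ : S₀ ⊆ (univ : Set ℝ) ×ˢ ((univ : Set E) ×ˢ closedBall (0 : E) R))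
    {F : ℕ → ℝ × E × E → ℝ}
    (hUI : UnifIntegrable F 1 ((volume : Measure (ℝ × E × E)).restrict S₀))
    (hUT : UnifTight F 1 ((volume : Measure (ℝ × E × E)).restrict S₀)) {η : ℝ} (hη : 0 < η) :
    ∃ h₀ > (0 : ℝ), ∀ n (t h : ℝ), 0 ≤ h → h ≤ h₀ →
      ∫⁻ q in Ioc t (t + h) ×ˢ (univ : Set (E × E)), ‖F n q‖ₑ
        ∂((volume : Measure (ℝ × E × E)).restrict S₀) ≤ ENNReal.ofReal η := by
  set μ : Measure (ℝ × E × E) := (volume : Measure (ℝ × E × E)).restrict S₀ with hμ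
  have hη3 : 0 < η / 3 := by positivity
  -- tightness
  obtain ⟨s, hsm, hsfin, hst⟩ := hUT.exists_measurableSet_indicator
    (ENNReal.ofReal_pos.2 hη3).ne'
  -- equi-integrability
  obtain ⟨θ, hθ, hUIθ⟩ := hUI hη3
  -- a large box in `x`
  set K : ℕ → Set (ℝ × E × E) := fun ρ => {q | ‖q.2.1‖ ≤ ρ} with hK
  have hKm : ∀ ρ, MeasurableSet (K ρ) := fun ρ =>
    measurableSet_le measurable_snd.fst.norm measurable_const
  have hlim : Tendsto (fun ρ : ℕ => μ (s \ K ρ)) atTop (𝓝 0) := by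
    have h1 : Tendsto (fun ρ : ℕ => μ (s \ K ρ)) atTop (𝓝 (μ (⋂ ρ : ℕ, s \ K ρ))) := by
      refine tendsto_measure_iInter_atTop (fun ρ => (hsm.diff (hKm ρ)).nullMeasurableSet) ?_
        ⟨0, ((measure_mono Set.sdiff_subset).trans_lt hsfin).ne⟩
      intro ρ ρ' hρ q hq
      refine ⟨hq.1, fun h => hq.2 ?_⟩
      simp only [hK, mem_setOf_eq] at h ⊢
      exact le_trans h (by exact_mod_cast hρ)
    have h2 : (⋂ ρ : ℕ, s \ K ρ) = ∅ := by
      ext q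
      simp only [mem_iInter, Set.mem_sdiff, hK, mem_setOf_eq, not_le, mem_empty_iff_false, iff_false,
        not_forall, not_and, not_lt]
      obtain ⟨ρ, hρ⟩ := exists_nat_ge ‖q.2.1‖
      exact ⟨ρ, fun _ => hρ⟩
    rwa [h2, measure_empty] at h1
  obtain ⟨ρ, hρ⟩ : ∃ ρ : ℕ, μ (s \ K ρ) ≤ ENNReal.ofReal θ := by
    have := (ENNReal.tendsto_atTop_zero.1 hlim) (ENNReal.ofReal θ) (ENNReal.ofReal_pos.2 hθ)
    obtain ⟨N, hN⟩ := this
    exact ⟨N, hN N le_rfl⟩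
  -- the measure of a slab inside the box
  set V : ℝ≥0∞ := volume (closedBall (0 : E) ρ) * volume (closedBall (0 : E) R) with hV
  have hVfin : V ≠ ∞ := ENNReal.mul_ne_top measure_closedBall_lt_top.ne measure_closedBall_lt_top.ne
  set h₀ : ℝ := θ / (V.toReal + 1) with hh₀
  have hh₀pos : 0 < h₀ := by positivity
  refine ⟨h₀, hh₀pos, fun n t h hh0 hhh => ?_⟩
  set A : Set (ℝ × E × E) := Ioc t (t + h) ×ˢ (univ : Set (E × E)) with hA
  have hAm : MeasurableSet A := measurableSet_Ioc.prod MeasurableSet.univ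
  have hAK : μ (A ∩ K ρ) ≤ ENNReal.ofReal θ := by
    have hsub : S₀ ∩ (A ∩ K ρ) ⊆ Ioc t (t + h) ×ˢ (closedBall (0 : E) ρ ×ˢ closedBall (0 : E) R) := by
      rintro q ⟨hq0, hqA, hqK⟩
      refine ⟨hqA.1, ?_, ?_⟩
      · simpa [hK] using hqK
      · exact (hS₀ hq0).2.2
    calc μ (A ∩ K ρ) = volume (A ∩ K ρ ∩ S₀) := Measure.restrict_apply (hAm.inter (hKm ρ))
      _ ≤ volume (Ioc t (t + h) ×ˢ (closedBall (0 : E) ρ ×ˢ closedBall (0 : E) R)) := by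
          refine measure_mono ?_
          rw [inter_comm]; exact hsub
      _ = ENNReal.ofReal h * V := by
          rw [show (volume : Measure (ℝ × E × E)) = (volume : Measure ℝ).prod
            ((volume : Measure E).prod volume) from rfl, Measure.prod_prod, Measure.prod_prod,
            Real.volume_Ioc, add_sub_cancel_left]
      _ ≤ ENNReal.ofReal h₀ * V := mul_le_mul' (ENNReal.ofReal_le_ofReal hhh) le_rfl
      _ ≤ ENNReal.ofReal θ := by
          rw [← ENNReal.ofReal_toReal hVfin, ← ENNReal.ofReal_mul hh₀pos.le]
          refine ENNReal.ofReal_le_ofReal ?_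
          rw [hh₀, div_mul_eq_mul_div, div_le_iff₀ (by positivity)]
          nlinarith [ENNReal.toReal_nonneg (a := V)]
  -- the three pieces
  have hcover : A ⊆ (A ∩ K ρ) ∪ (s \ K ρ) ∪ sᶜ := by
    intro q hq
    by_cases hqs : q ∈ s
    · by_cases hqK : q ∈ K ρ
      · exact Or.inl (Or.inl ⟨hq, hqK⟩)
      · exact Or.inl (Or.inr ⟨hqs, hqK⟩)
    · exact Or.inr hqs
  have hpiece : ∀ {B : Set (ℝ × E × E)}, MeasurableSet B →
      ∫⁻ q in B, ‖F n q‖ₑ ∂μ = eLpNorm (B.indicator (F n)) 1 μ := fun hB => by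
    rw [eLpNorm_indicator_eq_eLpNorm_restrict hB, eLpNorm_one_eq_lintegral_enorm]
  calc ∫⁻ q in A, ‖F n q‖ₑ ∂μ ≤ ∫⁻ q in (A ∩ K ρ) ∪ (s \ K ρ) ∪ sᶜ, ‖F n q‖ₑ ∂μ :=
        lintegral_mono_set hcover
    _ ≤ ∫⁻ q in (A ∩ K ρ) ∪ (s \ K ρ), ‖F n q‖ₑ ∂μ + ∫⁻ q in sᶜ, ‖F n q‖ₑ ∂μ :=
        lintegral_union_le _ _ _
    _ ≤ (∫⁻ q in A ∩ K ρ, ‖F n q‖ₑ ∂μ + ∫⁻ q in s \ K ρ, ‖F n q‖ₑ ∂μ) +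
          ∫⁻ q in sᶜ, ‖F n q‖ₑ ∂μ := add_le_add (lintegral_union_le _ _ _) le_rfl
    _ ≤ (ENNReal.ofReal (η / 3) + ENNReal.ofReal (η / 3)) + ENNReal.ofReal (η / 3) := by
        refine add_le_add (add_le_add ?_ ?_) ?_
        · rw [hpiece (hAm.inter (hKm ρ))]
          exact hUIθ n _ (hAm.inter (hKm ρ)) hAK
        · rw [hpiece (hsm.diff (hKm ρ))]
          exact hUIθ n _ (hsm.diff (hKm ρ)) hρ
        · rw [hpiece hsm.compl]
          exact hst n
    _ = ENNReal.ofReal η := by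
        rw [← ENNReal.ofReal_add hη3.le hη3.le, ← ENNReal.ofReal_add (by positivity) hη3.le]
        congr 1; ring

end Slab

end Literature.MathematicalPhysics.KineticTheory

namespace Literature.MathematicalPhysics.KineticTheory

section GlueHelpers

variable {E : Type*} [NormedAddCommGroup E] [InnerProductSpace ℝ E] [FiniteDimensional ℝ E]
  [MeasurableSpace E] [BorelSpace E]

/-- Invariance of the lower Lebesgue integral on phase space under the free-streaming shear
`(x, v) ↦ (x + s v, v)`. [folklore] -/
theorem lintegral_comp_freeShear (s : ℝ) (G : E × E → ℝ≥0∞) :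
    ∫⁻ z, G (z.1 + s • z.2, z.2) ∂((volume : Measure E).prod volume) =
      ∫⁻ z, G z ∂((volume : Measure E).prod volume) :=
  (measurePreserving_freeShear (E := E) s).lintegral_comp_emb (measurableEmbedding_freeShear s) G

/-- **Velocity tails from the second-moment bound**: under
`∫∫ g (1 + |x|² + |v|² + |log g|) ≤ C`, the mass carried by `|v| > R ≥ 0` is at most
`C / (1 + R²)`. [folklore] -/
theorem lintegral_velocityTail_le {g : E × E → ℝ} (hg : ∀ z, 0 ≤ g z) {C : ℝ}
    (hC : ∫⁻ z, ENNReal.ofReal (g z * (1 + ‖z.1‖ ^ 2 + ‖z.2‖ ^ 2 + |log (g z)|))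
      ∂((volume : Measure E).prod volume) ≤ ENNReal.ofReal C) {R : ℝ} (hR : 0 ≤ R) :
    ∫⁻ z, ENNReal.ofReal ((closedBall (0 : E) R)ᶜ.indicator (fun _ => (1 : ℝ)) z.2 * g z)
      ∂((volume : Measure E).prod volume) ≤ ENNReal.ofReal (C / (1 + R ^ 2)) := by
  have hR2 : 0 < 1 + R ^ 2 := by positivity
  calc ∫⁻ z, ENNReal.ofReal ((closedBall (0 : E) R)ᶜ.indicator (fun _ => (1 : ℝ)) z.2 * g z)
        ∂((volume : Measure E).prod volume)
      ≤ ∫⁻ z, ENNReal.ofReal ((1 + R ^ 2)⁻¹) *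
          ENNReal.ofReal (g z * (1 + ‖z.1‖ ^ 2 + ‖z.2‖ ^ 2 + |log (g z)|))
            ∂((volume : Measure E).prod volume) := by
        refine lintegral_mono fun z => ?_
        by_cases hz : z.2 ∈ (closedBall (0 : E) R)ᶜ
        · rw [indicator_of_mem hz, one_mul, ← ENNReal.ofReal_mul (inv_nonneg.2 hR2.le)]
          refine ENNReal.ofReal_le_ofReal ?_
          rw [mem_compl_iff, mem_closedBall, dist_zero_right, not_le] at hz
          have hv2 : R ^ 2 ≤ ‖z.2‖ ^ 2 := pow_le_pow_left₀ hR hz.le 2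
          have hw : 1 + R ^ 2 ≤ 1 + ‖z.1‖ ^ 2 + ‖z.2‖ ^ 2 + |log (g z)| := by
            nlinarith [sq_nonneg ‖z.1‖, abs_nonneg (log (g z))]
          rw [inv_mul_eq_div, le_div_iff₀ hR2]
          exact mul_le_mul_of_nonneg_left hw (hg z)
        · rw [indicator_of_notMem hz, zero_mul, ENNReal.ofReal_zero]
          exact bot_le
    _ = ENNReal.ofReal ((1 + R ^ 2)⁻¹) *
          ∫⁻ z, ENNReal.ofReal (g z * (1 + ‖z.1‖ ^ 2 + ‖z.2‖ ^ 2 + |log (g z)|))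
            ∂((volume : Measure E).prod volume) :=
        lintegral_const_mul' _ _ ENNReal.ofReal_ne_top
    _ ≤ ENNReal.ofReal ((1 + R ^ 2)⁻¹) * ENNReal.ofReal C := mul_le_mul' le_rfl hC
    _ = ENNReal.ofReal (C / (1 + R ^ 2)) := by
        rw [← ENNReal.ofReal_mul (inv_nonneg.2 hR2.le), inv_mul_eq_div]

omit [MeasurableSpace E] [BorelSpace E] [FiniteDimensional ℝ E] [InnerProductSpace ℝ E]
  [NormedAddCommGroup E] in
/-- The elementary five-term splitting behind the equicontinuity estimate: for
`0 ≤ β(a) ≤ a`, `0 ≤ β(b) ≤ b` and a set `S` of velocities,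
`|a - b| ≤ (a - β a) + (b - β b) + 1_S |β a - β b| + 1_{Sᶜ} a + 1_{Sᶜ} b`, in `[0, ∞]`. [folklore] -/
theorem enorm_sub_le_five {α : Type*} {S : Set α} {w : α} {a b βa βb : ℝ} (ha : βa ≤ a)
    (hβa : 0 ≤ βa) (hb : βb ≤ b) (hβb : 0 ≤ βb) :
    ‖a - b‖ₑ ≤ ENNReal.ofReal (a - βa) + ENNReal.ofReal (b - βb) +
      S.indicator (fun _ => ENNReal.ofReal |βa - βb|) w +
      ENNReal.ofReal (Sᶜ.indicator (fun _ => (1 : ℝ)) w * a) +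
      ENNReal.ofReal (Sᶜ.indicator (fun _ => (1 : ℝ)) w * b) := by
  rw [Real.enorm_eq_ofReal_abs]
  by_cases hw : w ∈ S
  · have hw' : w ∉ Sᶜ := fun h => h hw
    rw [indicator_of_mem hw, indicator_of_notMem hw', zero_mul, zero_mul, ENNReal.ofReal_zero,
      add_zero, add_zero, ← ENNReal.ofReal_add (by linarith) (by linarith),
      ← ENNReal.ofReal_add (by linarith) (abs_nonneg _)]
    refine ENNReal.ofReal_le_ofReal ?_
    calc |a - b| = |(a - βa) + (βa - βb) + (βb - b)| := by ring_nf
      _ ≤ |(a - βa) + (βa - βb)| + |βb - b| := abs_add_le _ _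
      _ ≤ |a - βa| + |βa - βb| + |βb - b| := by gcongr; exact abs_add_le _ _
      _ = (a - βa) + (b - βb) + |βa - βb| := by
          rw [abs_of_nonneg (by linarith : 0 ≤ a - βa), abs_of_nonpos (by linarith : βb - b ≤ 0)]
          ring
  · rw [indicator_of_notMem hw, indicator_of_mem (mem_compl hw), one_mul, one_mul, add_zero,
      ← ENNReal.ofReal_add (by linarith) (by linarith),
      ← ENNReal.ofReal_add (by linarith) (by linarith),
      ← ENNReal.ofReal_add (by linarith [add_nonneg (sub_nonneg.2 ha) (sub_nonneg.2 hb)])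
        (by linarith)]
    refine ENNReal.ofReal_le_ofReal ?_
    have : |a - b| ≤ a + b := by
      rw [abs_le]; constructor <;> linarith
    linarith [sub_nonneg.2 ha, sub_nonneg.2 hb]

/-- Indicators of velocity cylinders `E × T` are indicators in the velocity variable. [folklore] -/
theorem indicator_univ_prod_apply {α β γ : Type*} [Zero γ] (T : Set β) (F : α × β → γ) (z : α × β) :
    ((univ : Set α) ×ˢ T).indicator F z = T.indicator (fun _ => F z) z.2 := by
  by_cases h : z.2 ∈ T
  · rw [indicator_of_mem h, indicator_of_mem (show z ∈ (univ : Set α) ×ˢ T from ⟨mem_univ _, h⟩)]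
  · rw [indicator_of_notMem h, indicator_of_notMem (fun hz => h hz.2)]

/-- Joint continuity of an approximate solution composed with the time clamp `s ↦ max s 0`.
[folklore] -/
theorem IsDiPernaLionsApproximateSolution.continuous_clamp {δ : ℝ}
    {B : E × E → sphere (0 : E) 1 → ℝ} {f : ℝ → E → E → ℝ}
    (hf : IsDiPernaLionsApproximateSolution δ B f) {α : Type*} [TopologicalSpace α]
    {σ : α → ℝ} {y w : α → E} (hσ : Continuous σ) (hy : Continuous y) (hw : Continuous w) :
    Continuous fun a => f (max (σ a) 0) (y a) (w a) := by
  have h := hf.continuousOn_uncurry.comp_continuous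
    (f := fun a => ((max (σ a) 0, y a, w a) : ℝ × E × E)) (by fun_prop)
    (fun a => ⟨mem_Ici.2 (le_max_right _ _), mem_univ _⟩)
  exact h

/-- **Measurability of the normalised, weighted gain and loss terms** of an approximate solution
(composed with the time clamp `max s 0`, under which they are unchanged for `s ≥ 0`), jointly in
`(s, x, v)`. [folklore] -/
theorem IsDiPernaLionsApproximateSolution.measurable_gain_loss_terms_clamp {δ : ℝ}
    {B : E × E → sphere (0 : E) 1 → ℝ} {f : ℝ → E → E → ℝ}
    (hf : IsDiPernaLionsApproximateSolution δ B f) (hBm : Measurable (Function.uncurry B)) (δ' : ℝ) :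
    Measurable (fun q : ℝ × E × E => (1 + δ' * ∫ w, |f (max q.1 0) q.2.1 w|)⁻¹ *
        Literature.Analysis.FluidPDE.gainWith B (f (max q.1 0) q.2.1) (f (max q.1 0) q.2.1) q.2.2 / (1 + f (max q.1 0) q.2.1 q.2.2)) ∧
    Measurable (fun q : ℝ × E × E => (1 + δ' * ∫ w, |f (max q.1 0) q.2.1 w|)⁻¹ *
        Literature.Analysis.FluidPDE.lossWith B (f (max q.1 0) q.2.1) (f (max q.1 0) q.2.1) q.2.2 / (1 + f (max q.1 0) q.2.1 q.2.2)) := by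
  -- the normalisation factor
  have hI : Measurable fun p : ℝ × E => ∫ w, |f (max p.1 0) p.2 w| := by
    have hc : Continuous fun y : (ℝ × E) × E => |f (max y.1.1 0) y.1.2 y.2| :=
      continuous_abs.comp (hf.continuous_clamp (continuous_fst.comp continuous_fst)
        (continuous_snd.comp continuous_fst) continuous_snd)
    exact (hc.stronglyMeasurable.integral_prod_right' (ν := (volume : Measure E))).measurable
  have ha : Measurable fun q : ℝ × E × E => (1 + δ' * ∫ w, |f (max q.1 0) q.2.1 w|)⁻¹ :=
    (measurable_const.add (measurable_const.mul
      (hI.comp (measurable_fst.prodMk measurable_snd.fst)))).inv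
  -- the density along the parameter
  have hg : Measurable (Function.uncurry fun (q : ℝ × E × E) (w : E) => f (max q.1 0) q.2.1 w) :=
    (hf.continuous_clamp (continuous_fst.comp continuous_fst)
      (continuous_fst.comp (continuous_snd.comp continuous_fst)) continuous_snd).measurable
  have hden : Measurable fun q : ℝ × E × E => 1 + f (max q.1 0) q.2.1 q.2.2 :=
    measurable_const.add (hf.continuous_clamp continuous_fst (continuous_fst.comp continuous_snd)
      (continuous_snd.comp continuous_snd)).measurable
  have hG := measurable_gainWith_param (B := B) hBm hg measurable_snd.snd
  have hL := measurable_lossWith_param (B := B) hBm hg measurable_snd.snd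
  exact ⟨(ha.mul hG).div hden, (ha.mul hL).div hden⟩

end GlueHelpers

end Literature.MathematicalPhysics.KineticTheory

namespace Literature.MathematicalPhysics.KineticTheory

section Increment

variable {E : Type*} [NormedAddCommGroup E] [InnerProductSpace ℝ E] [FiniteDimensional ℝ E]
  [MeasurableSpace E] [BorelSpace E]

/-- **The inner part of the renormalised increment** (CIP 1994 §5.3 Step 10: from
`T g_δⁿ = (1 + δ fⁿ)⁻¹ Qⁿ(fⁿ,fⁿ)` along characteristics): for an approximate solution, `0 < κ ≤ 1`,
`0 ≤ t ≤ t₂` and `R`,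
`∫_{E × B_R} |β_κ(f♯(t₂)) - β_κ(f♯(t))| ≤ κ⁻¹ ∫_{(t,t₂] × E × B_R} (|G| + |L|)`, where `G`, `L` are
the normalised, weighted gain and loss terms `a Q±(f,f)/(1 + f)`, `a = (1 + δ ∫ f dv)⁻¹`. [cite: CIPDiluteGases1994, §5.3 Step 10 (pp. 151–152)] -/
theorem IsDiPernaLionsApproximateSolution.lintegral_inner_logTrunc_increment_le {δ : ℝ}
    {B : E × E → sphere (0 : E) 1 → ℝ} {f : ℝ → E → E → ℝ}
    (hf : IsDiPernaLionsApproximateSolution δ B f) (hδ : 0 ≤ δ)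
    (hBk : KineticTheory.IsDiPernaLionsKernel B) {Cb : ℝ} (hCb : ∀ p ω, B p ω ≤ Cb) {Rb : ℝ}
    (hRb : ∀ (z : E) ω, Rb ≤ ‖z‖ → B (z, 0) ω = 0) {κ : ℝ} (hκ : 0 < κ) (hκ1 : κ ≤ 1)
    {t t₂ : ℝ} (ht : 0 ≤ t) (htt : t ≤ t₂) (R : ℝ) :
    ∫⁻ z in (univ : Set E) ×ˢ closedBall (0 : E) R,
        ENNReal.ofReal |logTrunc κ (f t₂ (z.1 + t₂ • z.2) z.2) - logTrunc κ (f t (z.1 + t • z.2) z.2)|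
          ∂(volume.prod volume) ≤
      ENNReal.ofReal κ⁻¹ *
        ((∫⁻ q in Ioc t t₂ ×ˢ ((univ : Set E) ×ˢ closedBall (0 : E) R),
            ‖(1 + δ * ∫ w, |f q.1 q.2.1 w|)⁻¹ * Literature.Analysis.FluidPDE.gainWith B (f q.1 q.2.1) (f q.1 q.2.1) q.2.2 /
              (1 + f q.1 q.2.1 q.2.2)‖ₑ) +
          ∫⁻ q in Ioc t t₂ ×ˢ ((univ : Set E) ×ˢ closedBall (0 : E) R),
            ‖(1 + δ * ∫ w, |f q.1 q.2.1 w|)⁻¹ * Literature.Analysis.FluidPDE.lossWith B (f q.1 q.2.1) (f q.1 q.2.1) q.2.2 /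
              (1 + f q.1 q.2.1 q.2.2)‖ₑ) := by
  -- the terms, their clamped (globally measurable) versions and the majorant `Ψ`
  set G : ℝ × E × E → ℝ := fun q => (1 + δ * ∫ w, |f q.1 q.2.1 w|)⁻¹ *
    Literature.Analysis.FluidPDE.gainWith B (f q.1 q.2.1) (f q.1 q.2.1) q.2.2 / (1 + f q.1 q.2.1 q.2.2) with hGdef
  set L : ℝ × E × E → ℝ := fun q => (1 + δ * ∫ w, |f q.1 q.2.1 w|)⁻¹ *
    Literature.Analysis.FluidPDE.lossWith B (f q.1 q.2.1) (f q.1 q.2.1) q.2.2 / (1 + f q.1 q.2.1 q.2.2) with hLdef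
  set G' : ℝ × E × E → ℝ := fun q => (1 + δ * ∫ w, |f (max q.1 0) q.2.1 w|)⁻¹ *
    Literature.Analysis.FluidPDE.gainWith B (f (max q.1 0) q.2.1) (f (max q.1 0) q.2.1) q.2.2 / (1 + f (max q.1 0) q.2.1 q.2.2)
    with hG'def
  set L' : ℝ × E × E → ℝ := fun q => (1 + δ * ∫ w, |f (max q.1 0) q.2.1 w|)⁻¹ *
    Literature.Analysis.FluidPDE.lossWith B (f (max q.1 0) q.2.1) (f (max q.1 0) q.2.1) q.2.2 / (1 + f (max q.1 0) q.2.1 q.2.2)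
    with hL'def
  have hG'm : Measurable G' := (hf.measurable_gain_loss_terms_clamp hBk.measurable δ).1
  have hL'm : Measurable L' := (hf.measurable_gain_loss_terms_clamp hBk.measurable δ).2
  have hclamp : ∀ q : ℝ × E × E, 0 < q.1 → G' q = G q ∧ L' q = L q := fun q hq => by
    refine ⟨?_, ?_⟩ <;> simp only [hG'def, hGdef, hL'def, hLdef, max_eq_left hq.le]
  set Ψ : ℝ × E × E → ℝ≥0∞ := fun q => ENNReal.ofReal (κ⁻¹ * (G' q + L' q)) with hΨdef
  have hΨm : Measurable Ψ := (measurable_const.mul (hG'm.add hL'm)).ennreal_ofReal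
  have hΨ : ∀ s > (0 : ℝ), ∀ y v : E, ENNReal.ofReal ((1 + κ * f s y v)⁻¹ *
      |truncatedCollisionOp δ B (f s y) v|) ≤ Ψ (s, y, v) := by
    intro s hs y v
    obtain ⟨hc, ⟨K, hK⟩, hi⟩ := hf.slice_velocity hs.le y
    obtain ⟨hgi, hli⟩ := gain_loss_integrable_of_bounded_kernel hBk hCb hRb hc hK hi v
    have hQ := abs_collisionOpWith_le hBk.nonneg (fun w => hf.nonneg s hs.le y w) v hgi hli
    have h := renormalised_term_le hQ (hf.nonneg s hs.le y v) hδ hκ hκ1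
    obtain ⟨h1, h2⟩ := hclamp (s, y, v) hs
    simp only [hΨdef]
    rw [h1, h2]
    exact ENNReal.ofReal_le_ofReal h
  -- integrate the characteristic bound over `E × B_R`
  have hbox := lintegral_box_le_of_characteristic_bound (u := fun s y v => logTrunc κ (f s y v)) hΨm
    (t := t) (t₂ := t₂) (fun x v => hf.ofReal_abs_logTrunc_sub_le hκ hΨ ht htt x v) R
  refine hbox.trans ?_
  -- bound the slab integral of `Ψ`
  have hboxm : MeasurableSet (Ioc t t₂ ×ˢ ((univ : Set E) ×ˢ closedBall (0 : E) R)) :=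
    measurableSet_Ioc.prod (MeasurableSet.univ.prod measurableSet_closedBall)
  have hpos : ∀ q ∈ Ioc t t₂ ×ˢ ((univ : Set E) ×ˢ closedBall (0 : E) R), 0 < q.1 :=
    fun q hq => ht.trans_lt hq.1.1
  calc ∫⁻ q in Ioc t t₂ ×ˢ ((univ : Set E) ×ˢ closedBall (0 : E) R), Ψ q
      ≤ ∫⁻ q in Ioc t t₂ ×ˢ ((univ : Set E) ×ˢ closedBall (0 : E) R),
          ENNReal.ofReal κ⁻¹ * (‖G' q‖ₑ + ‖L' q‖ₑ) := by
        refine lintegral_mono fun q => ?_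
        simp only [hΨdef]
        rw [ENNReal.ofReal_mul (inv_nonneg.2 hκ.le)]
        refine mul_le_mul' le_rfl ?_
        exact ENNReal.ofReal_add_le.trans (add_le_add (Real.ofReal_le_enorm _) (Real.ofReal_le_enorm _))
    _ = ENNReal.ofReal κ⁻¹ * ((∫⁻ q in Ioc t t₂ ×ˢ ((univ : Set E) ×ˢ closedBall (0 : E) R), ‖G' q‖ₑ) +
          ∫⁻ q in Ioc t t₂ ×ˢ ((univ : Set E) ×ˢ closedBall (0 : E) R), ‖L' q‖ₑ) := by
        rw [lintegral_const_mul' _ _ ENNReal.ofReal_ne_top, lintegral_add_left hG'm.enorm]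
    _ = _ := by
        congr 2
        · exact setLIntegral_congr_fun hboxm fun q hq => by rw [(hclamp q (hpos q hq)).1]
        · exact setLIntegral_congr_fun hboxm fun q hq => by rw [(hclamp q (hpos q hq)).2]

/-- **The basic equicontinuity estimate for one approximate solution** (CIP 1994 §5.3 Step 10,
pp. 151–152, made quantitative): for `0 < κ ≤ 1`, `0 ≤ t ≤ t₂`, `M > 1`, `R ≥ 0` and a
mass–moment–entropy bound `C` at the times `t`, `t₂`,
`‖f♯(t₂) - f♯(t)‖_{L¹} ≤ 2 (κ M + (log M)⁻¹) C + κ⁻¹ ∫_{(t,t₂] × E × B_R} (|G| + |L|) + 2 C/(1 + R²)`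
((3.30) for the truncation error, the transport of `β_κ(f)` along characteristics for the
middle term, the second moments for the velocity tails). [cite: CIPDiluteGases1994, §5.3 Step 10 (pp. 151–152)] -/
theorem IsDiPernaLionsApproximateSolution.lintegral_sharp_increment_le {δ : ℝ}
    {B : E × E → sphere (0 : E) 1 → ℝ} {f : ℝ → E → E → ℝ}
    (hf : IsDiPernaLionsApproximateSolution δ B f) (hδ : 0 ≤ δ)
    (hBk : KineticTheory.IsDiPernaLionsKernel B) {Cb : ℝ} (hCb : ∀ p ω, B p ω ≤ Cb) {Rb : ℝ}
    (hRb : ∀ (z : E) ω, Rb ≤ ‖z‖ → B (z, 0) ω = 0) {κ : ℝ} (hκ : 0 < κ) (hκ1 : κ ≤ 1)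
    {t t₂ : ℝ} (ht : 0 ≤ t) (htt : t ≤ t₂) {C : ℝ}
    (hCt : ∫⁻ z : E × E, ENNReal.ofReal (f t z.1 z.2 *
      (1 + ‖z.1‖ ^ 2 + ‖z.2‖ ^ 2 + |log (f t z.1 z.2)|)) ∂(volume.prod volume) ≤ ENNReal.ofReal C)
    (hCt₂ : ∫⁻ z : E × E, ENNReal.ofReal (f t₂ z.1 z.2 *
      (1 + ‖z.1‖ ^ 2 + ‖z.2‖ ^ 2 + |log (f t₂ z.1 z.2)|)) ∂(volume.prod volume) ≤ ENNReal.ofReal C)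
    {M : ℝ} (hM : 1 < M) {R : ℝ} (hR : 0 ≤ R) :
    ∫⁻ z : E × E, ‖f t₂ (z.1 + t₂ • z.2) z.2 - f t (z.1 + t • z.2) z.2‖ₑ ∂(volume.prod volume) ≤
      ENNReal.ofReal ((κ * M + (log M)⁻¹) * C) + ENNReal.ofReal ((κ * M + (log M)⁻¹) * C) +
      ENNReal.ofReal κ⁻¹ *
        ((∫⁻ q in Ioc t t₂ ×ˢ ((univ : Set E) ×ˢ closedBall (0 : E) R),
            ‖(1 + δ * ∫ w, |f q.1 q.2.1 w|)⁻¹ * Literature.Analysis.FluidPDE.gainWith B (f q.1 q.2.1) (f q.1 q.2.1) q.2.2 /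
              (1 + f q.1 q.2.1 q.2.2)‖ₑ) +
          ∫⁻ q in Ioc t t₂ ×ˢ ((univ : Set E) ×ˢ closedBall (0 : E) R),
            ‖(1 + δ * ∫ w, |f q.1 q.2.1 w|)⁻¹ * Literature.Analysis.FluidPDE.lossWith B (f q.1 q.2.1) (f q.1 q.2.1) q.2.2 /
              (1 + f q.1 q.2.1 q.2.2)‖ₑ) +
      ENNReal.ofReal (C / (1 + R ^ 2)) + ENNReal.ofReal (C / (1 + R ^ 2)) := by
  have ht₂ : 0 ≤ t₂ := ht.trans htt
  set a : E × E → ℝ := fun z => f t₂ (z.1 + t₂ • z.2) z.2 with hadef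
  set b : E × E → ℝ := fun z => f t (z.1 + t • z.2) z.2 with hbdef
  have ha0 : ∀ z, 0 ≤ a z := fun z => hf.nonneg t₂ ht₂ _ _
  have hb0 : ∀ z, 0 ≤ b z := fun z => hf.nonneg t ht _ _
  have ham : Measurable a :=
    ((hf.contDiff_slice t₂ ht₂).continuous.comp
      (by fun_prop : Continuous fun z : E × E => (z.1 + t₂ • z.2, z.2))).measurable
  have hbm : Measurable b :=
    ((hf.contDiff_slice t ht).continuous.comp
      (by fun_prop : Continuous fun z : E × E => (z.1 + t • z.2, z.2))).measurable
  have hβm := measurable_logTrunc κ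
  set S : Set E := closedBall (0 : E) R with hSdef
  have hSm : MeasurableSet S := measurableSet_closedBall
  -- the five terms
  set A1 : E × E → ℝ≥0∞ := fun z => ENNReal.ofReal (a z - logTrunc κ (a z)) with hA1
  set A2 : E × E → ℝ≥0∞ := fun z => ENNReal.ofReal (b z - logTrunc κ (b z)) with hA2
  set A3 : E × E → ℝ≥0∞ := fun z =>
    S.indicator (fun _ => ENNReal.ofReal |logTrunc κ (a z) - logTrunc κ (b z)|) z.2 with hA3
  set A4 : E × E → ℝ≥0∞ := fun z => ENNReal.ofReal (Sᶜ.indicator (fun _ => (1 : ℝ)) z.2 * a z)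
    with hA4
  set A5 : E × E → ℝ≥0∞ := fun z => ENNReal.ofReal (Sᶜ.indicator (fun _ => (1 : ℝ)) z.2 * b z)
    with hA5
  have hpt : ∀ z, ‖a z - b z‖ₑ ≤ A1 z + A2 z + A3 z + A4 z + A5 z := fun z =>
    enorm_sub_le_five (logTrunc_le hκ (ha0 z)) (logTrunc_nonneg hκ (ha0 z))
      (logTrunc_le hκ (hb0 z)) (logTrunc_nonneg hκ (hb0 z))
  have hA1m : Measurable A1 := (ham.sub (hβm.comp ham)).ennreal_ofReal
  have hA2m : Measurable A2 := (hbm.sub (hβm.comp hbm)).ennreal_ofReal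
  have hA3m : Measurable A3 := by
    have h1 : Measurable fun z : E × E =>
        ENNReal.ofReal |logTrunc κ (a z) - logTrunc κ (b z)| :=
      ((hβm.comp ham).sub (hβm.comp hbm)).abs.ennreal_ofReal
    have : A3 = ((univ : Set E) ×ˢ S).indicator fun z : E × E =>
        ENNReal.ofReal |logTrunc κ (a z) - logTrunc κ (b z)| := by
      funext z; rw [indicator_univ_prod_apply]
    rw [this]
    exact h1.indicator (MeasurableSet.univ.prod hSm)
  have hA4m : Measurable A4 :=
    (((measurable_const.indicator hSm.compl).comp measurable_snd).mul ham).ennreal_ofReal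
  -- the five bounds
  have h1 : ∫⁻ z, A1 z ∂((volume : Measure E).prod volume) ≤
      ENNReal.ofReal ((κ * M + (log M)⁻¹) * C) := by
    calc ∫⁻ z, A1 z ∂((volume : Measure E).prod volume)
        = ∫⁻ y, ENNReal.ofReal (f t₂ y.1 y.2 - logTrunc κ (f t₂ y.1 y.2))
            ∂((volume : Measure E).prod volume) :=
          lintegral_comp_freeShear t₂ (fun y : E × E =>
            ENNReal.ofReal (f t₂ y.1 y.2 - logTrunc κ (f t₂ y.1 y.2)))
      _ ≤ _ := lintegral_sub_logTrunc_le (g := fun y : E × E => f t₂ y.1 y.2)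
          (fun y => hf.nonneg t₂ ht₂ _ _) hCt₂ hκ hM
  have h2 : ∫⁻ z, A2 z ∂((volume : Measure E).prod volume) ≤
      ENNReal.ofReal ((κ * M + (log M)⁻¹) * C) := by
    calc ∫⁻ z, A2 z ∂((volume : Measure E).prod volume)
        = ∫⁻ y, ENNReal.ofReal (f t y.1 y.2 - logTrunc κ (f t y.1 y.2))
            ∂((volume : Measure E).prod volume) :=
          lintegral_comp_freeShear t (fun y : E × E =>
            ENNReal.ofReal (f t y.1 y.2 - logTrunc κ (f t y.1 y.2)))
      _ ≤ _ := lintegral_sub_logTrunc_le (g := fun y : E × E => f t y.1 y.2)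
          (fun y => hf.nonneg t ht _ _) hCt hκ hM
  have h3 : ∫⁻ z, A3 z ∂((volume : Measure E).prod volume) ≤ ENNReal.ofReal κ⁻¹ *
      ((∫⁻ q in Ioc t t₂ ×ˢ ((univ : Set E) ×ˢ closedBall (0 : E) R),
          ‖(1 + δ * ∫ w, |f q.1 q.2.1 w|)⁻¹ * Literature.Analysis.FluidPDE.gainWith B (f q.1 q.2.1) (f q.1 q.2.1) q.2.2 /
            (1 + f q.1 q.2.1 q.2.2)‖ₑ) +
        ∫⁻ q in Ioc t t₂ ×ˢ ((univ : Set E) ×ˢ closedBall (0 : E) R),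
          ‖(1 + δ * ∫ w, |f q.1 q.2.1 w|)⁻¹ * Literature.Analysis.FluidPDE.lossWith B (f q.1 q.2.1) (f q.1 q.2.1) q.2.2 /
            (1 + f q.1 q.2.1 q.2.2)‖ₑ) := by
    have : ∫⁻ z, A3 z ∂((volume : Measure E).prod volume) =
        ∫⁻ z in (univ : Set E) ×ˢ closedBall (0 : E) R,
          ENNReal.ofReal |logTrunc κ (f t₂ (z.1 + t₂ • z.2) z.2) - logTrunc κ (f t (z.1 + t • z.2) z.2)|
            ∂((volume : Measure E).prod volume) := by
      rw [← lintegral_indicator (MeasurableSet.univ.prod hSm)]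
      refine lintegral_congr fun z => ?_
      rw [indicator_univ_prod_apply]
    rw [this]
    exact hf.lintegral_inner_logTrunc_increment_le hδ hBk hCb hRb hκ hκ1 ht htt R
  have h4 : ∫⁻ z, A4 z ∂((volume : Measure E).prod volume) ≤ ENNReal.ofReal (C / (1 + R ^ 2)) := by
    calc ∫⁻ z, A4 z ∂((volume : Measure E).prod volume)
        = ∫⁻ y, ENNReal.ofReal (Sᶜ.indicator (fun _ => (1 : ℝ)) y.2 * f t₂ y.1 y.2)
            ∂((volume : Measure E).prod volume) :=
          lintegral_comp_freeShear t₂ (fun y : E × E =>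
            ENNReal.ofReal (Sᶜ.indicator (fun _ => (1 : ℝ)) y.2 * f t₂ y.1 y.2))
      _ ≤ _ := lintegral_velocityTail_le (g := fun y : E × E => f t₂ y.1 y.2)
          (fun y => hf.nonneg t₂ ht₂ _ _) hCt₂ hR
  have h5 : ∫⁻ z, A5 z ∂((volume : Measure E).prod volume) ≤ ENNReal.ofReal (C / (1 + R ^ 2)) := by
    calc ∫⁻ z, A5 z ∂((volume : Measure E).prod volume)
        = ∫⁻ y, ENNReal.ofReal (Sᶜ.indicator (fun _ => (1 : ℝ)) y.2 * f t y.1 y.2)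
            ∂((volume : Measure E).prod volume) :=
          lintegral_comp_freeShear t (fun y : E × E =>
            ENNReal.ofReal (Sᶜ.indicator (fun _ => (1 : ℝ)) y.2 * f t y.1 y.2))
      _ ≤ _ := lintegral_velocityTail_le (g := fun y : E × E => f t y.1 y.2)
          (fun y => hf.nonneg t ht _ _) hCt hR
  -- assemble
  calc ∫⁻ z : E × E, ‖f t₂ (z.1 + t₂ • z.2) z.2 - f t (z.1 + t • z.2) z.2‖ₑ ∂(volume.prod volume)
      ≤ ∫⁻ z, (A1 z + A2 z + A3 z + A4 z + A5 z) ∂((volume : Measure E).prod volume) :=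
        lintegral_mono hpt
    _ = (∫⁻ z, A1 z ∂((volume : Measure E).prod volume)) +
          (∫⁻ z, A2 z ∂((volume : Measure E).prod volume)) +
          (∫⁻ z, A3 z ∂((volume : Measure E).prod volume)) +
          (∫⁻ z, A4 z ∂((volume : Measure E).prod volume)) +
          ∫⁻ z, A5 z ∂((volume : Measure E).prod volume) := by
        have hm2 : Measurable fun z => A1 z + A2 z := hA1m.add hA2m
        have hm3 : Measurable fun z => A1 z + A2 z + A3 z := hm2.add hA3m
        have hm4 : Measurable fun z => A1 z + A2 z + A3 z + A4 z := hm3.add hA4m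
        rw [lintegral_add_left hm4, lintegral_add_left hm3, lintegral_add_left hm2,
          lintegral_add_left hA1m]
    _ ≤ _ := add_le_add (add_le_add (add_le_add (add_le_add h1 h2) h3) h4) h5

end Increment

end Literature.MathematicalPhysics.KineticTheory

namespace Literature.MathematicalPhysics.KineticTheory

section Main

universe u

/-- **The equicontinuity fact from the weak compactness of the collision terms**: (EQ)
`Kinetic.diPernaLions_approx_equicontinuous` (CIP 1994 §5.3 Step 10, pp. 151–152:
`sup_{t ∈ [0,T]} sup_n ‖f^{n♯}(t + h) - f^{n♯}(t)‖_{L¹} → 0` as `h → 0`) follows from (D3)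
`Kinetic.diPernaLions_approx_collisionTerms_weaklyCompact` (CIP Lemma 5.3.7). Given `ε`, choose
`R` (velocity tails `≤ ε/8` by the second moments), `M` and the renormalisation parameter `κ`
((3.30): truncation errors `≤ ε/8`), then `h₀` from the uniform smallness of thin-slab integrals
of the equi-integrable, uniformly tight normalised collision terms (`Kinetic.exists_slab_lintegral_le`),
and apply `lintegral_sharp_increment_le`. [cite: CIPDiluteGases1994, §5.3 Step 10 (pp. 151–152)] -/
theorem diPernaLions_approx_equicontinuous_of
    (hD3 : diPernaLions_approx_collisionTerms_weaklyCompact.{u}) :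
    diPernaLions_approx_equicontinuous.{u} := by
  intro E _ _ _ _ _ B hB f₀ hf₀ δ Bseq fseq hδ hanti hδ0 hker hdata hsol hbd T hT ε hε
  -- the uniform mass–moment–entropy constant on `[0, T + 2]`
  obtain ⟨C₀, hC₀⟩ := hbd.massEntropy_le (T + 2) (by linarith)
  set C : ℝ := max C₀ 1 with hCdef
  have hC1 : 1 ≤ C := le_max_right _ _
  have hC0 : 0 < C := by linarith
  have hC : ∀ n, ∀ s ∈ Icc (0 : ℝ) (T + 2), ∫⁻ z : E × E, ENNReal.ofReal (fseq n s z.1 z.2 *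
      (1 + ‖z.1‖ ^ 2 + ‖z.2‖ ^ 2 + |log (fseq n s z.1 z.2)|)) ∂(volume.prod volume) ≤
        ENNReal.ofReal C :=
    fun n s hs => (hC₀ n s hs).trans (ENNReal.ofReal_le_ofReal (le_max_left _ _))
  -- the velocity cut-off `R`
  set R : ℝ := Real.sqrt (8 * C / ε) with hRdef
  have hR0 : 0 ≤ R := Real.sqrt_nonneg _
  have hR2 : R ^ 2 = 8 * C / ε := Real.sq_sqrt (by positivity)
  have htail : C / (1 + R ^ 2) ≤ ε / 8 := by
    rw [div_le_iff₀ (by positivity), hR2]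
    have : ε / 8 * (8 * C / ε) = C := by field_simp
    nlinarith
  -- the truncation height `M` and the renormalisation parameter `κ`
  set M : ℝ := Real.exp (16 * C / ε) with hMdef
  have hM : 1 < M := Real.one_lt_exp_iff.2 (by positivity)
  have hM0 : 0 < M := Real.exp_pos _
  have hlogM : (Real.log M)⁻¹ * C = ε / 16 := by
    rw [hMdef, Real.log_exp]
    field_simp
  set κ : ℝ := min 1 (ε / (16 * M * C)) with hκdef
  have hκ0 : 0 < κ := lt_min one_pos (by positivity)
  have hκ1 : κ ≤ 1 := min_le_left _ _
  have hκMC : κ * M * C ≤ ε / 16 := by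
    have h1 : κ ≤ ε / (16 * M * C) := min_le_right _ _
    calc κ * M * C = κ * (M * C) := by ring
      _ ≤ ε / (16 * M * C) * (M * C) := mul_le_mul_of_nonneg_right h1 (by positivity)
      _ = ε / 16 := by field_simp
  have h30 : (κ * M + (Real.log M)⁻¹) * C ≤ ε / 8 := by
    have : (κ * M + (Real.log M)⁻¹) * C = κ * M * C + (Real.log M)⁻¹ * C := by ring
    rw [this, hlogM]
    linarith
  -- the slab smallness from (D3)
  set η : ℝ := κ * ε / 8 with hηdef
  have hη : 0 < η := by positivity
  have hmid : κ⁻¹ * (η + η) = ε / 4 := by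
    rw [hηdef]
    field_simp
    ring
  set S₀ : Set (ℝ × E × E) := Ioo 0 (T + 2) ×ˢ ((univ : Set E) ×ˢ closedBall (0 : E) R) with hS₀def
  have hS₀ : S₀ ⊆ (univ : Set ℝ) ×ˢ ((univ : Set E) ×ˢ closedBall (0 : E) R) :=
    prod_mono (subset_univ _) Subset.rfl
  obtain ⟨⟨hUIg, hUTg⟩, ⟨hUIl, hUTl⟩⟩ := hD3 hB hf₀ hδ hanti hδ0 hker hdata hsol hbd (T + 2) R
  obtain ⟨h₁, hh₁, hslab₁⟩ := exists_slab_lintegral_le hS₀ hUIg.unifIntegrable hUTg hη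
  obtain ⟨h₂, hh₂, hslab₂⟩ := exists_slab_lintegral_le hS₀ hUIl.unifIntegrable hUTl hη
  refine ⟨min 1 (min h₁ h₂), lt_min one_pos (lt_min hh₁ hh₂), fun n t ht h hh => ?_⟩
  obtain ⟨ht0, htT⟩ := ht
  obtain ⟨hh0, hhle⟩ := hh
  have hh1 : h ≤ 1 := hhle.trans (min_le_left _ _)
  have hhh₁ : h ≤ h₁ := hhle.trans ((min_le_right _ _).trans (min_le_left _ _))
  have hhh₂ : h ≤ h₂ := hhle.trans ((min_le_right _ _).trans (min_le_right _ _))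
  have htt : t ≤ t + h := by linarith
  have htI : t ∈ Icc (0 : ℝ) (T + 2) := ⟨ht0, by linarith⟩
  have ht₂I : t + h ∈ Icc (0 : ℝ) (T + 2) := ⟨by linarith, by linarith⟩
  -- the estimate for `fseq n`
  obtain ⟨Cb, hCb⟩ := hker.bounded n
  obtain ⟨Rb, hRb⟩ := hker.eq_zero_of_le n
  have hest := (hsol n).lintegral_sharp_increment_le (hδ n).le (hker.isDiPernaLionsKernel n) hCb
    hRb hκ0 hκ1 ht0 htt (hC n t htI) (hC n (t + h) ht₂I) hM hR0
  -- the slab terms are small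
  have hsub : Ioc t (t + h) ×ˢ ((univ : Set E) ×ˢ closedBall (0 : E) R) ⊆
      (Ioc t (t + h) ×ˢ (univ : Set (E × E))) ∩ S₀ := by
    rintro q ⟨hq1, hq2⟩
    exact ⟨⟨hq1, mem_univ _⟩, ⟨⟨ht0.trans_lt hq1.1, by linarith [hq1.2]⟩, hq2⟩⟩
  have hmeasA : MeasurableSet (Ioc t (t + h) ×ˢ (univ : Set (E × E))) :=
    measurableSet_Ioc.prod MeasurableSet.univ
  have hG : ∫⁻ q in Ioc t (t + h) ×ˢ ((univ : Set E) ×ˢ closedBall (0 : E) R),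
      ‖(1 + δ n * ∫ w, |fseq n q.1 q.2.1 w|)⁻¹ *
        Literature.Analysis.FluidPDE.gainWith (Bseq n) (fseq n q.1 q.2.1) (fseq n q.1 q.2.1) q.2.2 /
          (1 + fseq n q.1 q.2.1 q.2.2)‖ₑ ≤ ENNReal.ofReal η := by
    calc _ ≤ ∫⁻ q in (Ioc t (t + h) ×ˢ (univ : Set (E × E))) ∩ S₀,
          ‖(1 + δ n * ∫ w, |fseq n q.1 q.2.1 w|)⁻¹ *
            Literature.Analysis.FluidPDE.gainWith (Bseq n) (fseq n q.1 q.2.1) (fseq n q.1 q.2.1) q.2.2 /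
              (1 + fseq n q.1 q.2.1 q.2.2)‖ₑ := lintegral_mono_set hsub
      _ = ∫⁻ q in Ioc t (t + h) ×ˢ (univ : Set (E × E)),
          ‖(1 + δ n * ∫ w, |fseq n q.1 q.2.1 w|)⁻¹ *
            Literature.Analysis.FluidPDE.gainWith (Bseq n) (fseq n q.1 q.2.1) (fseq n q.1 q.2.1) q.2.2 /
              (1 + fseq n q.1 q.2.1 q.2.2)‖ₑ ∂((volume : Measure (ℝ × E × E)).restrict S₀) := by
          rw [Measure.restrict_restrict hmeasA]
      _ ≤ ENNReal.ofReal η := hslab₁ n t h hh0 hhh₁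
  have hL : ∫⁻ q in Ioc t (t + h) ×ˢ ((univ : Set E) ×ˢ closedBall (0 : E) R),
      ‖(1 + δ n * ∫ w, |fseq n q.1 q.2.1 w|)⁻¹ *
        Literature.Analysis.FluidPDE.lossWith (Bseq n) (fseq n q.1 q.2.1) (fseq n q.1 q.2.1) q.2.2 /
          (1 + fseq n q.1 q.2.1 q.2.2)‖ₑ ≤ ENNReal.ofReal η := by
    calc _ ≤ ∫⁻ q in (Ioc t (t + h) ×ˢ (univ : Set (E × E))) ∩ S₀,
          ‖(1 + δ n * ∫ w, |fseq n q.1 q.2.1 w|)⁻¹ *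
            Literature.Analysis.FluidPDE.lossWith (Bseq n) (fseq n q.1 q.2.1) (fseq n q.1 q.2.1) q.2.2 /
              (1 + fseq n q.1 q.2.1 q.2.2)‖ₑ := lintegral_mono_set hsub
      _ = ∫⁻ q in Ioc t (t + h) ×ˢ (univ : Set (E × E)),
          ‖(1 + δ n * ∫ w, |fseq n q.1 q.2.1 w|)⁻¹ *
            Literature.Analysis.FluidPDE.lossWith (Bseq n) (fseq n q.1 q.2.1) (fseq n q.1 q.2.1) q.2.2 /
              (1 + fseq n q.1 q.2.1 q.2.2)‖ₑ ∂((volume : Measure (ℝ × E × E)).restrict S₀) := by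
          rw [Measure.restrict_restrict hmeasA]
      _ ≤ ENNReal.ofReal η := hslab₂ n t h hh0 hhh₂
  -- combine
  have h8 : ENNReal.ofReal ((κ * M + (Real.log M)⁻¹) * C) ≤ ENNReal.ofReal (ε / 8) :=
    ENNReal.ofReal_le_ofReal h30
  have h8' : ENNReal.ofReal (C / (1 + R ^ 2)) ≤ ENNReal.ofReal (ε / 8) :=
    ENNReal.ofReal_le_ofReal htail
  have hsum : ENNReal.ofReal (ε / 8) + ENNReal.ofReal (ε / 8) +
      ENNReal.ofReal κ⁻¹ * (ENNReal.ofReal η + ENNReal.ofReal η) +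
      ENNReal.ofReal (ε / 8) + ENNReal.ofReal (ε / 8) ≤ ENNReal.ofReal ε := by
    rw [← ENNReal.ofReal_add hη.le hη.le, ← ENNReal.ofReal_mul (inv_nonneg.2 hκ0.le), hmid,
      ← ENNReal.ofReal_add (by positivity) (by positivity),
      ← ENNReal.ofReal_add (by positivity) (by positivity),
      ← ENNReal.ofReal_add (by positivity) (by positivity),
      ← ENNReal.ofReal_add (by positivity) (by positivity)]
    exact ENNReal.ofReal_le_ofReal (by linarith)
  calc ∫⁻ z : E × E, ‖alongFreeFlow (fseq n) (t + h) z.1 z.2 - alongFreeFlow (fseq n) t z.1 z.2‖ₑ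
        ∂((volume : Measure E).prod volume)
      = ∫⁻ z : E × E, ‖fseq n (t + h) (z.1 + (t + h) • z.2) z.2 - fseq n t (z.1 + t • z.2) z.2‖ₑ
        ∂((volume : Measure E).prod volume) := rfl
    _ ≤ _ := hest
    _ ≤ ENNReal.ofReal (ε / 8) + ENNReal.ofReal (ε / 8) +
          ENNReal.ofReal κ⁻¹ * (ENNReal.ofReal η + ENNReal.ofReal η) +
          ENNReal.ofReal (ε / 8) + ENNReal.ofReal (ε / 8) :=
        add_le_add (add_le_add (add_le_add (add_le_add h8 h8)
          (mul_le_mul' le_rfl (add_le_add hG hL))) h8') h8'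
    _ ≤ ENNReal.ofReal ε := hsum

end Main

end Literature.MathematicalPhysics.KineticTheory
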